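import Summits.HubbardSuperconductivity.HubbardSuperconductivity.Theorems.ParentFirstSMAMottGap
import Literature.MathematicalPhysics.QuantumLattice.OnSitePairingAlgebra

/-!
# Stub `stub_holePunchWave_commute_doublon` (S4) of line `birth`
# (crux `BoundCoherentDWavePairs`, item stmt-HubbardSuperconductivity-10770, route `ParentFirstSMA`)

The punch modes of the two-sided single-mode binding criterion (stub S2 of the line): for spins
`σ ≠ τ` and coefficients `c`, the projected annihilation wave `Q = Σ_x c_x • c_{xσ}(1 − n_{xτ})`
(remove a `σ` electron from a site carrying no `τ` electron) commutes with the doublon number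
`D = Σ_y n_{y↑} n_{y↓}` — for `y ≠ x` all four number operators commute with `c_{xσ}` and
`n_{xτ}`; for `y = x` both products vanish (`(1 − n_{xτ}) n_{xτ} = 0`, `n_{xσ} c_{xσ} = 0`) — and
it maps `(N+1)`-particle vectors to `N`-particle vectors. This is the annihilation-side analogue
of the landed `holeWave_commute_doublon` / `isNParticle_holeWave_mulVec` (the refill wave of
crux #2), so that `projectedSingleModeBound_proof` applies to `Q` with `U` dropping out. The
one-orbital identities `n_p c_a = c_a n_p` (`p ≠ a`) and `n_a c_a = 0` are the landed
`numberAt_mul_annihilation_of_ne` / `numberAt_mul_annihilation_self` (`OnSitePairingAlgebra`).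

No definitions are introduced.
-/

-- the mandated namespace `Summit.<Summit>.<Problem>.Theorems` repeats `HubbardSuperconductivity`
set_option linter.dupNamespace false

noncomputable section

namespace Summit.HubbardSuperconductivity.HubbardSuperconductivity.Theorems.ParentFirstSMA

open Matrix Literature.MathematicalPhysics.QuantumLattice

/-! ### One-orbital identities on the annihilation side -/

section Orbital

-- `[DecidableEq (Finset ι)]` (behind `1 : Matrix (Finset ι) (Finset ι) ℂ`) is a parameter where
-- needed, so that the lemmas apply whichever instance path the user was elaborated with.
variable {ι : Type*} [LinearOrder ι] [Fintype ι]

-- `n_p c_a = c_a n_p` (`p ≠ a`), `n_a c_a = 0` and `c_a c_a = 0` are the landed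
-- `numberAt_mul_annihilation_of_ne`, `numberAt_mul_annihilation_self` (`OnSitePairingAlgebra`) and
-- `LiebThm1.annihilation_mul_self` (`HubbardWave0LiebProofs`).

/-- `(1 − n_b) n_b = 0`. Bratteli–Robinson II §5.2.2. [folklore] -/
theorem one_sub_numberAt_mul_numberAt [DecidableEq (Finset ι)] (b : ι) :
    (1 - numberAt b) * numberAt b = 0 := by
  rw [sub_mul, one_mul, (numberAt_idempotent b).eq, sub_self]

/-- Same site: `c_a (1 − n_b)` commutes with `n_a n_b` — both products vanish
(`(1 − n_b) n_b = 0`, `n_a c_a = 0`). [folklore] -/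
theorem punch_commute_numberAt_mul_numberAt_self [DecidableEq (Finset ι)] {a b : ι} :
    Commute (annihilation a * (1 - numberAt b)) (numberAt a * numberAt b) := by
  have hcomm : (1 - numberAt b) * numberAt a = numberAt a * (1 - numberAt b) := by
    rw [sub_mul, mul_sub, one_mul, mul_one, (numberAt_commute b a).eq]
  have hL : annihilation a * (1 - numberAt b) * (numberAt a * numberAt b) = 0 := by
    calc annihilation a * (1 - numberAt b) * (numberAt a * numberAt b)
        = annihilation a * ((1 - numberAt b) * numberAt a) * numberAt b := by
          simp only [mul_assoc]
      _ = annihilation a * numberAt a * ((1 - numberAt b) * numberAt b) := by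
          rw [hcomm]; simp only [mul_assoc]
      _ = 0 := by rw [one_sub_numberAt_mul_numberAt, mul_zero]
  have hR : numberAt a * numberAt b * (annihilation a * (1 - numberAt b)) = 0 := by
    calc numberAt a * numberAt b * (annihilation a * (1 - numberAt b))
        = numberAt b * (numberAt a * annihilation a) * (1 - numberAt b) := by
          rw [(numberAt_commute a b).eq]; simp only [mul_assoc]
      _ = 0 := by rw [numberAt_mul_annihilation_self, mul_zero, zero_mul]
  change annihilation a * (1 - numberAt b) * (numberAt a * numberAt b) =
    numberAt a * numberAt b * (annihilation a * (1 - numberAt b))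
  rw [hL, hR]

/-- Different sites: if `p` and `q` differ from both `a` and `b`, then `c_a (1 − n_b)` commutes
with `n_p n_q` factor by factor. [folklore] -/
theorem punch_commute_numberAt_mul_numberAt_of_ne [DecidableEq (Finset ι)] {a b p q : ι} (hpa : p ≠ a)
    (hqa : q ≠ a) :
    Commute (annihilation a * (1 - numberAt b)) (numberAt p * numberAt q) := by
  have ca : Commute (annihilation a) (numberAt p * numberAt q) :=
    Commute.mul_right (numberAt_mul_annihilation_of_ne hpa).symm
      (numberAt_mul_annihilation_of_ne hqa).symm
  have cb : Commute (1 - numberAt b) (numberAt p * numberAt q) :=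
    Commute.sub_left (Commute.one_left _)
      (Commute.mul_right (numberAt_commute b p) (numberAt_commute b q))
  exact Commute.mul_left ca cb

end Orbital

/-! ### The punch wave on the Hubbard orbitals -/

section PunchWave

-- The `DecidableEq (Finset (Orb Λ))` instance behind `1 : Matrix _ _ ℂ` is taken as a parameter so
-- that the lemmas unify with the route statement whichever instance path it was elaborated with.
variable {Λ : Type*} [LinearOrder Λ] [Fintype Λ]

/-- `numberOp x σ` is `numberAt (orb x σ)` (definitional). [folklore] -/
theorem numberOp_eq_numberAt (x : Λ) (σ : Fin 2) :
    (numberOp x σ : Matrix (Finset (Orb Λ)) (Finset (Orb Λ)) ℂ) = numberAt (orb x σ) := rfl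

/-- `c_{xσ}(1 − n_{xτ})` (`σ ≠ τ`) commutes with every `n_{y↑} n_{y↓}`. [folklore] -/
theorem holePunch_commute_doublon [DecidableEq (Finset (Orb Λ))] {σ τ : Fin 2} (hστ : σ ≠ τ)
    (x y : Λ) :
    Commute (annihilation (orb x σ) * (1 - numberOp x τ)) (numberOp y 0 * numberOp y 1) := by
  simp only [numberOp_eq_numberAt]
  by_cases hxy : y = x
  · subst hxy
    -- `{σ, τ} = {0, 1}`: the doublon number at `y` is `n_{yσ} n_{yτ}` up to the order of factors
    have hd : numberAt (orb y 0) * numberAt (orb y 1) = numberAt (orb y σ) * numberAt (orb y τ) := by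
      fin_cases σ <;> fin_cases τ
      · exact absurd rfl hστ
      · rfl
      · exact (numberAt_commute _ _).eq
      · exact absurd rfl hστ
    rw [hd]
    exact punch_commute_numberAt_mul_numberAt_self
  · have h0 : orb y 0 ≠ orb x σ := by
      rw [Ne, orb_eq_orb_iff]; simp [hxy]
    have h1 : orb y 1 ≠ orb x σ := by
      rw [Ne, orb_eq_orb_iff]; simp [hxy]
    exact punch_commute_numberAt_mul_numberAt_of_ne h0 h1

/-- A punch wave `Σ_x c_x • c_{xσ}(1 − n_{xτ})` (`σ ≠ τ`) commutes with the doublon number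
`Σ_y n_{y↑} n_{y↓}`. [folklore] -/
theorem holePunchWave_commute_doublon [DecidableEq (Finset (Orb Λ))] {σ τ : Fin 2} (hστ : σ ≠ τ)
    (c : Λ → ℂ) :
    Commute (∑ x, c x • (annihilation (orb x σ) * (1 - numberOp x τ)))
      (∑ y, numberOp y 0 * numberOp y 1) :=
  Commute.sum_left _ _ _ fun x _ =>
    Commute.smul_left (Commute.sum_right _ _ _ fun y _ => holePunch_commute_doublon hστ x y) (c x)

/-- `1 − n_{xτ}` preserves the particle number. [folklore] -/
theorem isNParticle_one_sub_numberOp_mulVec' [DecidableEq (Finset (Orb Λ))] (x : Λ) (τ : Fin 2)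
    {N : ℕ} {φ : Fock (Orb Λ)} (hφ : IsNParticle N φ) :
    IsNParticle N ((1 - numberOp x τ) *ᵥ φ) := by
  intro s hs
  rw [Matrix.sub_mulVec, Matrix.one_mulVec, Pi.sub_apply, LiebTwo.numberOp_mulVec, hφ s hs]
  split_ifs <;> simp

/-- `c • c_{xσ}(1 − n_{xτ})` lowers the particle number by one. [folklore] -/
theorem isNParticle_smul_holePunch_mulVec [DecidableEq (Finset (Orb Λ))] (x : Λ) (σ τ : Fin 2)
    (c : ℂ) {N : ℕ} {φ : Fock (Orb Λ)} (hφ : IsNParticle (N + 1) φ) :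
    IsNParticle N ((c • (annihilation (orb x σ) * (1 - numberOp x τ))) *ᵥ φ) := by
  rw [Matrix.smul_mulVec, ← Matrix.mulVec_mulVec]
  intro s hs
  rw [Pi.smul_apply, IsNParticle.annihilation_mulVec_holds
    (isNParticle_one_sub_numberOp_mulVec' x τ hφ) (orb x σ) s hs, smul_zero]

/-- A punch wave lowers the particle number by one: if `φ` is an `(N+1)`-particle vector then
`(Σ_x c_x • c_{xσ}(1 − n_{xτ})) φ` is an `N`-particle vector. [folklore] -/
theorem isNParticle_holePunchWave_mulVec [DecidableEq (Finset (Orb Λ))] (σ τ : Fin 2) (c : Λ → ℂ)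
    {N : ℕ} {φ : Fock (Orb Λ)} (hφ : IsNParticle (N + 1) φ) :
    IsNParticle N ((∑ x, c x • (annihilation (orb x σ) * (1 - numberOp x τ))) *ᵥ φ) := by
  rw [Matrix.sum_mulVec]
  have hmem : ∀ x ∈ (Finset.univ : Finset Λ),
      (c x • (annihilation (orb x σ) * (1 - numberOp x τ))) *ᵥ φ ∈ nParticleSubmodule N :=
    fun x _ => (mem_nParticleSubmodule_iff _ _).2 (isNParticle_smul_holePunch_mulVec x σ τ (c x) hφ)
  exact (mem_nParticleSubmodule_iff _ _).1 ((nParticleSubmodule N).sum_mem hmem)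

end PunchWave

/-- **Stub S4 of line `birth` (crux `BoundCoherentDWavePairs`, stmt-HubbardSuperconductivity-10770):
punch modes commute with the doublon number and lower `N`.** For spins `σ ≠ τ` and coefficients
`c`, `Q = Σ_x c_x • c_{xσ}(1 − n_{xτ})` commutes with `Σ_y n_{y↑} n_{y↓}` and maps
`(N+1)`-particle vectors to `N`-particle vectors. [folklore] -/
theorem stub_holePunchWave_commute_doublon :
    ∀ (L : ℕ) (σ τ : Fin 2), σ ≠ τ → ∀ c : FermionTorus 2 L → ℂ,
      Commute (∑ x : FermionTorus 2 L, c x • (annihilation (orb x σ) * (1 - numberOp x τ)))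
          (∑ y : FermionTorus 2 L, numberOp y 0 * numberOp y 1) ∧
        ∀ (N : ℕ) (φ : Fock (Orb (FermionTorus 2 L))), IsNParticle (N + 1) φ →
          IsNParticle N
            ((∑ x : FermionTorus 2 L, c x • (annihilation (orb x σ) * (1 - numberOp x τ))) *ᵥ φ) :=
  fun _ σ τ hστ c =>
    ⟨holePunchWave_commute_doublon hστ c, fun _ _ hφ => isNParticle_holePunchWave_mulVec σ τ c hφ⟩

end Summit.HubbardSuperconductivity.HubbardSuperconductivity.Theorems.ParentFirstSMA

end
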